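import Mathlib
import HarnessLib
import Literature.Analysis.FluidPDE.SelfSimilar
import Literature.Analysis.FluidPDE.LocalTypeI
import Literature.Analysis.FluidPDE.VectorCalculus
import Literature.Analysis.FluidPDE.AncientMildCompactness
import Literature.Analysis.FluidPDE.NSBoundedMildOseenClassical
import Literature.Analysis.UnboundedOperators.HeatKernel
import Summits.NavierStokesRegularity.NavierStokesRegularity.Theorems.LocalSineTubeDoorProfileAlignedWindowRigidityAncient
import Summits.NavierStokesRegularity.NavierStokesRegularity.Theorems.PoloidalWindowDoorPoloidalWindowRigidityOneSlice
import Summits.NavierStokesRegularity.NavierStokesRegularity.Theorems.PoloidalWindowDoorPoloidalWindowRigidityFlat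
import Summits.NavierStokesRegularity.NavierStokesRegularity.Theorems.PoloidalWindowDoorPoloidalWindowRigidityZoomOut

/-!
# Route `PoloidalWindowDoor`, crux `PoloidalWindowRigidity` (K2, stmt-NavierStokesRegularity-19708) —
# SPATIALLY PERIODIC PROFILES OF THE TYPE-I CLASS ARE TRIVIAL (mechanism «zoom-out symmetry gain»)

Cell ns-regularity-ideate, seat ns-poloidal-K2-p2 (stub-worker; lands `--supports` the crux, `--as helper`).  For the
WHOLE route class `𝔓(C)` (Type-I rate `‖v(t)‖ ≤ C/√(−t)`, continuous on the open slab, unit-viscosity Oseen-mild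
between negative times, divergence-free slices — no poloidality), a profile with a spatial period, `v(s, y + ℓ) =
v(s, y)` for one `ℓ ≠ 0` and all `s < 0`, vanishes identically:

* `tendsto_zero_of_periodic` — ZOOM-OUT SYMMETRY GAIN: the recentred zooms `c_k v(c_k² s, x_k + c_k y)`, `c_k → ∞`
  (in the class by `…ZoomOut.class_zoom`), have periods `ℓ/c_k → 0`; by KNSS 2009 Lemma 6.1 (tree
  `KNSS2009_lemma61_typeI_rate`) a subsequence converges to a profile of the class invariant under ALL translations
  along `ℓ`, hence zero (tree `eq_zero_of_translate_eq`, the ancient planar Liouville theorem with the Type-I rate);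
  recentring at points `x_k` with `√(−t_k)‖v(t_k, x_k)‖ > ε` this forces `sup_x √(−t)‖v(t,x)‖ → 0` as `t → −∞`;
* `eq_zero_of_spatiallyPeriodic` / `nonflatLiouville_of_spatiallyPeriodic` — then `…ZoomOut.eq_zero_of_tendsto_zero`
  (backward ε-regularity + analyticity) gives `v ≡ 0`;
* `eq_zero_of_twistedPeriodic` — `v(s, y + ℓ) = M v(s, y)` with `M` a linear isometry of finite order (a discrete
  screw symmetry with rational angle, a glide reflection, any crystallographic symmetry with a translation part):
  a power is a pure period, so `v ≡ 0`.

So the residue of K2 may assume: the profile has no spatial period (no lattice / rod / layer symmetry, no rational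
discrete screw, no glide).  (Irrational discrete screws, point groups fixing the vertical, and rotating /
discrete self-similarity about a vertical axis are NOT settled by this mechanism: their zoom-outs gain no
translation.)

WHAT THIS IS NOT: not a claim about Navier–Stokes regularity and not the open residue — one more settled stratum,
for the whole Type-I class (bears_on LADDER-NS N0, rung N0-LocalTubeDoorPoloidal).
-/

noncomputable section

-- the summit and its single sub-problem share the name (CONVENTIONS §1), as in every Theorems file
set_option linter.dupNamespace false

namespace Summit.NavierStokesRegularity.NavierStokesRegularity.Theorems.PoloidalWindowDoorPoloidalWindowRigidityPeriodic

open MeasureTheory Set Function Filter Topology TopologicalSpace Metric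
open scoped RealInnerProductSpace InnerProductSpace
open Literature.Analysis Literature.Analysis.FluidPDE
open Summit.NavierStokesRegularity.NavierStokesRegularity.Theorems.LocalSineTubeDoorProfileAlignedWindowRigidity
open Summit.NavierStokesRegularity.NavierStokesRegularity.Theorems.LocalSineTubeDoorProfileAlignedWindowRigidityAncient
open Summit.NavierStokesRegularity.NavierStokesRegularity.Theorems.PoloidalWindowDoorPoloidalWindowRigidityZoomOut

variable {C : ℝ} {v : ℝ → EuclideanSpace ℝ (Fin 3) → EuclideanSpace ℝ (Fin 3)}

/-! ### 2. zoom-out symmetry gain: a periodic profile is small at `−∞` -/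

/-- Integer multiples of a period are periods. -/
theorem periodic_int {ℓ : EuclideanSpace ℝ (Fin 3)} (hper : ∀ s < 0, ∀ y, v s (y + ℓ) = v s y) :
    ∀ s < 0, ∀ (m : ℤ) (y : EuclideanSpace ℝ (Fin 3)), v s (y + (m : ℝ) • ℓ) = v s y := by
  intro s hs
  have hnat : ∀ (n : ℕ) (y : EuclideanSpace ℝ (Fin 3)), v s (y + (n : ℝ) • ℓ) = v s y := by
    intro n
    induction n with
    | zero => intro y; simp
    | succ n ih =>
      intro y
      have e : y + ((n + 1 : ℕ) : ℝ) • ℓ = (y + (n : ℝ) • ℓ) + ℓ := by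
        rw [Nat.cast_succ, add_smul, one_smul, add_assoc]
      rw [e, hper s hs, ih]
  intro m y
  obtain ⟨n, rfl | rfl⟩ := Int.eq_nat_or_neg m
  · exact_mod_cast hnat n y
  · have h := hnat n (y + ((-(n : ℤ) : ℤ) : ℝ) • ℓ)
    rw [add_assoc, ← add_smul] at h
    have e : ((-(n : ℤ) : ℤ) : ℝ) + (n : ℝ) = 0 := by push_cast; ring
    rw [e, zero_smul, add_zero] at h
    exact h.symm

/-- `⌊h c⌋ / c → h` as `c → +∞`. -/
theorem tendsto_floor_mul_div {c : ℕ → ℝ} (hc : Tendsto c atTop atTop) (h : ℝ) :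
    Tendsto (fun j => (⌊h * c j⌋ : ℝ) / c j) atTop (𝓝 h) := by
  have hpos : ∀ᶠ j in atTop, 0 < c j := hc.eventually (eventually_gt_atTop 0)
  have hinv : Tendsto (fun j => (c j)⁻¹) atTop (𝓝 0) := tendsto_inv_atTop_zero.comp hc
  have hlow : Tendsto (fun j => h - (c j)⁻¹) atTop (𝓝 h) := by
    simpa using tendsto_const_nhds.sub hinv
  refine tendsto_of_tendsto_of_tendsto_of_le_of_le' hlow tendsto_const_nhds ?_ ?_
  · filter_upwards [hpos] with j hj
    have h1 : h * c j - 1 < (⌊h * c j⌋ : ℝ) := Int.sub_one_lt_floor _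
    rw [le_div_iff₀ hj]
    have : (h - (c j)⁻¹) * c j = h * c j - 1 := by field_simp
    linarith
  · filter_upwards [hpos] with j hj
    rw [div_le_iff₀ hj]
    exact Int.floor_le _

/-- **Zoom-out symmetry gain.** A profile of the class with a spatial period `ℓ ≠ 0` has scale-invariant size
tending to zero backward in time: for every `ε > 0` there is `T < 0` with `√(−t)‖v(t,x)‖ ≤ ε` for all `t < T`,
`x`.  Otherwise recentred zoom-outs `c_k v(c_k² s, x_k + c_k y)` (`c_k = √(−t_k) → ∞`) with
`‖(𝒵_k v)(−1, 0)‖ > ε` converge along a subsequence (KNSS Lemma 6.1, tree `KNSS2009_lemma61_typeI_rate`) to a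
profile `W` of the class with `‖W(−1,0)‖ ≥ ε`; but the periods `ℓ/c_k → 0` make `W` invariant under every
translation along `ℓ`, so `W ≡ 0` by the ancient planar Liouville theorem (tree `eq_zero_of_translate_eq`). -/
theorem tendsto_zero_of_periodic (hrate : HasTypeITimeDecay C v)
    (hcont : ContinuousOn (uncurry v) (Iio (0 : ℝ) ×ˢ univ))
    (hmild : ∀ s t : ℝ, s < t → t < 0 → ∀ x,
      v t x = UnboundedOperators.heatExtension (v s) (t - s) x - oseenDuhamel 1 s v v t x)
    (hdiv : ∀ t < 0, VectorCalculus.IsDivFree (v t)) {ℓ : EuclideanSpace ℝ (Fin 3)} (hℓ : ℓ ≠ 0)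
    (hper : ∀ s < 0, ∀ y, v s (y + ℓ) = v s y) :
    ∀ ε : ℝ, 0 < ε → ∃ T : ℝ, T < 0 ∧ ∀ t < T, ∀ x, Real.sqrt (-t) * ‖v t x‖ ≤ ε := by
  intro ε hε
  by_contra hcon
  push Not at hcon
  -- a bad sequence `t_k < −(k+1)`, `x_k`
  have hch : ∀ k : ℕ, ∃ t : ℝ, t < -((k : ℝ) + 1) ∧ ∃ x, ε < Real.sqrt (-t) * ‖v t x‖ := fun k =>
    hcon _ (by have : (0 : ℝ) ≤ k := Nat.cast_nonneg k; linarith)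
  choose tk htk xk hxk using hch
  have htk0 : ∀ k, tk k < 0 := fun k => by
    have := htk k; have : (0 : ℝ) ≤ k := Nat.cast_nonneg k; linarith
  -- zoom factors `c_k = √(−t_k) → ∞`
  set c : ℕ → ℝ := fun k => Real.sqrt (-tk k) with hcdef
  have hc0 : ∀ k, 0 < c k := fun k => Real.sqrt_pos.2 (neg_pos.2 (htk0 k))
  have hc2 : ∀ k, c k ^ 2 = -tk k := fun k => Real.sq_sqrt (neg_pos.2 (htk0 k)).le
  have hcinf : Tendsto c atTop atTop := by
    have h1 : Tendsto (fun k : ℕ => Real.sqrt ((k : ℝ) + 1)) atTop atTop :=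
      Real.tendsto_sqrt_atTop.comp (tendsto_natCast_atTop_atTop.atTop_add tendsto_const_nhds)
    refine tendsto_atTop_mono (fun k => ?_) h1
    exact Real.sqrt_le_sqrt (by have := htk k; linarith)
  -- the zoomed fields and their class data
  set w : ℕ → ℝ → EuclideanSpace ℝ (Fin 3) → EuclideanSpace ℝ (Fin 3) :=
    fun k s y => c k • v (c k ^ 2 * s) (xk k + c k • y) with hwdef
  have hw : ∀ k, HasTypeITimeDecay C (w k) ∧ ContinuousOn (uncurry (w k)) (Iio (0 : ℝ) ×ˢ univ) ∧
      (∀ s t : ℝ, s < t → t < 0 → ∀ x, w k t x =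
        UnboundedOperators.heatExtension (w k s) (t - s) x - oseenDuhamel 1 s (w k) (w k) t x) ∧
      (∀ t < 0, VectorCalculus.IsDivFree (w k t)) := fun k =>
    class_zoom hrate hcont hmild hdiv (hc0 k) (xk k)
  -- compactness (KNSS Lemma 6.1, Type-I-rate form)
  have hA : Tendsto (fun k : ℕ => -((k : ℝ) + 1)) atTop atBot :=
    tendsto_neg_atTop_atBot.comp (tendsto_natCast_atTop_atTop.atTop_add tendsto_const_nhds)
  have hcontk : ∀ k : ℕ, ContinuousOn (uncurry (w k)) (Ioo (-((k : ℝ) + 1)) 0 ×ˢ univ) := fun k =>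
    (hw k).2.1.mono (prod_mono Ioo_subset_Iio_self Subset.rfl)
  have hdivk : ∀ k : ℕ, ∀ t ∈ Ioo (-((k : ℝ) + 1)) (0 : ℝ), IsWeaklyDivFree (w k t) := by
    intro k t ht
    have hC1 : ContDiff ℝ 1 (w k t) :=
      (analyticOnNhd_slice (hw k).2.1 (bdd_of_hasTypeITimeDecay (hw k).1) (hw k).2.2.1 ht.2).contDiff
    exact VectorCalculus.IsDivFree.isWeaklyDivFree_holds ((hw k).2.2.2 t ht.2) hC1
  have hmildk : ∀ k : ℕ, ∀ s t : ℝ, -((k : ℝ) + 1) < s → s < t → t < 0 → ∀ x, w k t x =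
      UnboundedOperators.heatExtension (w k s) (t - s) x - oseenDuhamel 1 s (w k) (w k) t x :=
    fun k s t _ hst ht x => (hw k).2.2.1 s t hst ht x
  have hIk : ∀ k : ℕ, ∀ τ ∈ Ioo (-((k : ℝ) + 1)) (0 : ℝ), ∀ x, Real.sqrt (-τ) * ‖w k τ x‖ ≤ C := by
    intro k τ hτ x
    have h := (hw k).1 τ hτ.2 x
    have hs : 0 < Real.sqrt (-τ) := Real.sqrt_pos.2 (neg_pos.2 hτ.2)
    rw [mul_comm, ← le_div_iff₀ hs]
    exact h
  obtain ⟨φ, W, hφ, hWc, hWdiv, hWI, hWmild, -, hpt, hloc⟩ :=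
    KNSS2009_lemma61_typeI_rate hA hcontk hdivk hmildk hIk
  -- class data of the limit
  have hWrate : HasTypeITimeDecay C W := fun t ht x => by
    have hs : 0 < Real.sqrt (-t) := Real.sqrt_pos.2 (neg_pos.2 ht)
    rw [le_div_iff₀ hs, mul_comm]
    exact hWI t ht x
  have hWbdd := bdd_of_hasTypeITimeDecay hWrate
  have hWdiv' : ∀ t < 0, VectorCalculus.IsDivFree (W t) := fun t ht =>
    IsWeaklyDivFree.isDivFree_of_contDiff (analyticOnNhd_slice hWc hWbdd hWmild ht).contDiff (hWdiv t ht)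
  -- (i) the limit is not small at `(−1, 0)`
  have hbig : ∀ j, ε ≤ ‖w (φ j) (-1) 0‖ := by
    intro j
    have e : w (φ j) (-1) 0 = c (φ j) • v (tk (φ j)) (xk (φ j)) := by
      simp only [hwdef, mul_neg_one, hc2, neg_neg, smul_zero, add_zero]
    rw [e, norm_smul, Real.norm_of_nonneg (hc0 _).le]
    exact (hxk (φ j)).le
  have hnorm : ε ≤ ‖W (-1) 0‖ :=
    ge_of_tendsto ((hpt (-1) (by norm_num) 0).norm) (Eventually.of_forall hbig)
  -- (ii) the limit is invariant under every translation along `ℓ`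
  have hWinv : ∀ s < 0, ∀ (y : EuclideanSpace ℝ (Fin 3)) (h : ℝ), W s (y + h • ℓ) = W s y := by
    intro s hs y h
    -- the zooms have the periods `m/c_k`, `m ∈ ℤ`
    have hwper : ∀ (k : ℕ) (m : ℤ) (z : EuclideanSpace ℝ (Fin 3)),
        w k s (z + ((m : ℝ) / c k) • ℓ) = w k s z := by
      intro k m z
      have e : xk k + c k • (z + ((m : ℝ) / c k) • ℓ) = (xk k + c k • z) + (m : ℝ) • ℓ := by
        rw [smul_add, smul_smul, mul_div_cancel₀ _ (hc0 k).ne', add_assoc]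
      simp only [hwdef]
      rw [e, periodic_int hper _ (mul_neg_of_pos_of_neg (pow_pos (hc0 k) 2) hs)]
    -- points `g_j = y + (⌊h c⌋/c) ℓ → y + h ℓ` along the subsequence
    set g : ℕ → EuclideanSpace ℝ (Fin 3) := fun j => y + ((⌊h * c (φ j)⌋ : ℝ) / c (φ j)) • ℓ with hgdef
    have hg : Tendsto g atTop (𝓝 (y + h • ℓ)) :=
      tendsto_const_nhds.add ((tendsto_floor_mul_div (hcinf.comp hφ.tendsto_atTop) h).smul_const ℓ)
    have h1 : Tendsto (fun j => w (φ j) s (g j)) atTop (𝓝 (W s (y + h • ℓ))) :=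
      (hloc s hs).tendsto_comp (continuous_slice hWc hs).continuousAt hg
    have h2 : (fun j => w (φ j) s (g j)) = fun j => w (φ j) s y := funext fun j => hwper _ _ _
    rw [h2] at h1
    exact tendsto_nhds_unique h1 (hpt s hs y)
  -- (iii) so the limit vanishes — contradiction
  have hW0 := eq_zero_of_translate_eq hWrate hWc hWmild hWdiv' hℓ fun t ht y l => hWinv t ht y l
  have hz : W (-1) 0 = 0 := hW0 (-1) (by norm_num) 0
  rw [hz, norm_zero] at hnorm
  linarith

/-! ### main statements -/

/-- **SPATIALLY PERIODIC PROFILES OF THE TYPE-I CLASS ARE TRIVIAL.** A profile of the route's Type-I class with a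
spatial period — `v(s, y + ℓ) = v(s, y)` for one `ℓ ≠ 0`, all `s < 0` and all `y` — vanishes identically. -/
theorem eq_zero_of_spatiallyPeriodic (hrate : HasTypeITimeDecay C v)
    (hcont : ContinuousOn (uncurry v) (Iio (0 : ℝ) ×ˢ univ))
    (hmild : ∀ s t : ℝ, s < t → t < 0 → ∀ x,
      v t x = UnboundedOperators.heatExtension (v s) (t - s) x - oseenDuhamel 1 s v v t x)
    (hdiv : ∀ t < 0, VectorCalculus.IsDivFree (v t)) {ℓ : EuclideanSpace ℝ (Fin 3)} (hℓ : ℓ ≠ 0)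
    (hper : ∀ s < 0, ∀ y, v s (y + ℓ) = v s y) : ∀ t < 0, ∀ x, v t x = 0 :=
  eq_zero_of_tendsto_zero hrate hcont hmild (tendsto_zero_of_periodic hrate hcont hmild hdiv hℓ hper)

/-- **The spatially periodic stratum is empty**: such a profile is not backward-singular. -/
theorem nonflatLiouville_of_spatiallyPeriodic (hrate : HasTypeITimeDecay C v)
    (hcont : ContinuousOn (uncurry v) (Iio (0 : ℝ) ×ˢ univ))
    (hmild : ∀ s t : ℝ, s < t → t < 0 → ∀ x,
      v t x = UnboundedOperators.heatExtension (v s) (t - s) x - oseenDuhamel 1 s v v t x)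
    (hdiv : ∀ t < 0, VectorCalculus.IsDivFree (v t)) {ℓ : EuclideanSpace ℝ (Fin 3)} (hℓ : ℓ ≠ 0)
    (hper : ∀ s < 0, ∀ y, v s (y + ℓ) = v s y) : ¬ IsBackwardSingularPoint v 0 :=
  Summit.NavierStokesRegularity.NavierStokesRegularity.Theorems.PoloidalWindowDoorPoloidalWindowRigidityFlat.not_backwardSingular_of_zero
    (eq_zero_of_spatiallyPeriodic hrate hcont hmild hdiv hℓ hper)

/-- **Twisted periodicity of finite order is empty too.** If `v(s, y + ℓ) = M (v(s, y))` for all `s < 0`, `y`, with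
`ℓ ≠ 0` and `M` a linear isometry one of whose powers is the identity (`M^[n] = id`, `n ≥ 1`) — a DISCRETE SCREW
symmetry with rational angle (`M` = rotation by `2πp/n`, `ℓ` along the axis), a GLIDE REFLECTION (`M` a
reflection fixing `ℓ`, `n = 2`), any crystallographic symmetry with a translation part — then `v` has the period
`n ℓ` and vanishes identically. -/
theorem eq_zero_of_twistedPeriodic (hrate : HasTypeITimeDecay C v)
    (hcont : ContinuousOn (uncurry v) (Iio (0 : ℝ) ×ˢ univ))
    (hmild : ∀ s t : ℝ, s < t → t < 0 → ∀ x,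
      v t x = UnboundedOperators.heatExtension (v s) (t - s) x - oseenDuhamel 1 s v v t x)
    (hdiv : ∀ t < 0, VectorCalculus.IsDivFree (v t)) {ℓ : EuclideanSpace ℝ (Fin 3)} (hℓ : ℓ ≠ 0)
    (M : EuclideanSpace ℝ (Fin 3) ≃ₗᵢ[ℝ] EuclideanSpace ℝ (Fin 3)) {n : ℕ} (hn : 0 < n)
    (hM : ∀ z, (⇑M)^[n] z = z)
    (htw : ∀ s < 0, ∀ y, v s (y + ℓ) = M (v s y)) : ∀ t < 0, ∀ x, v t x = 0 := by
  -- `v(s, y + k ℓ) = M^k (v(s, y))`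
  have hiter : ∀ s < 0, ∀ (k : ℕ) (y : EuclideanSpace ℝ (Fin 3)), v s (y + (k : ℝ) • ℓ) = (⇑M)^[k] (v s y) := by
    intro s hs k
    induction k with
    | zero => intro y; simp
    | succ k ih =>
      intro y
      have e : y + ((k + 1 : ℕ) : ℝ) • ℓ = (y + (k : ℝ) • ℓ) + ℓ := by
        rw [Nat.cast_succ, add_smul, one_smul, add_assoc]
      rw [e, htw s hs, ih, Function.iterate_succ_apply']
  have hnℓ : (n : ℝ) • ℓ ≠ 0 := smul_ne_zero (Nat.cast_ne_zero.2 hn.ne') hℓ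
  exact eq_zero_of_spatiallyPeriodic hrate hcont hmild hdiv hnℓ fun s hs y => by rw [hiter s hs n y, hM]

end Summit.NavierStokesRegularity.NavierStokesRegularity.Theorems.PoloidalWindowDoorPoloidalWindowRigidityPeriodic

end
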